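import Summits.QuantumFields.YangMills.Theorems.BalabanUVNodesPortS1FEStepHalves
import Summits.QuantumFields.YangMills.Theorems.BalabanUVNodesPortS1FEStepUc
import Summits.QuantumFields.YangMills.Theorems.BalabanUVNodesPortS1ClassRegDefs
import Summits.QuantumFields.YangMills.Theorems.BalabanUVNodesPortS1ClassTwins
import Literature.MathematicalPhysics.QuantumFieldTheory.Balaban1983to89.TreeLengthTorusGeometry

/-!
# PT-S1 ∕ ⟨27930⟩ — THE `FEStepReg` SUB-SPLIT, HOISTED: W-format polymer activity systems, the three candidate letters S₁ `FEChartLawReg`, S₃ `FEPolymerActivitiesReg`,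
# S₄ `FEPolymerResummation`, S₂ `RegClassNestsUc` (the (α) edition of ▶ PT-A's ✓`ClassNestsUc`), and the kernel-checked glue `feStepReg_of_polymerPieces`

Cell `ym-nodeO-ideate` ∕ `ym-balaban-port`, DEFINER seat `ym-nodeO-def-1` (gen 39) — HOIST COMMISSIONED by ★★★ director-ym №634 (2) (nodeO STATUS 2026-08-31 l.6150) of ◇ lens-1 g15's
located memo v21 `nodeO-cover/LENS-1-NODE-v21-FESTEPREG-SUBSPLIT.md` + sketch `nodeO-cover/LENS1g15FEStepPolymerSplit.lean` (a88b047dfbb078c7 · 178 l., farm rc 0 · 0 sorry; ◆ CRIT-1 C36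
SURVIVES-PRICED); `--kind definition --supports stmt-QuantumFields-27930 --as helper`; count-neutral.  [I] = [Balaban1987RG1], [II] = [Balaban1988RG2Cluster].

WHAT THIS FILE IS (the sketch's §1–§3 bytes VERBATIM + one bridge).  №634 (1) ADOPTED as the BRICK OF RECORD under `stub_FEstepReg`:
`∀ F, FEStepReg F ⟸ stub_P0C ∧ S₁ FEChartLawReg (XL) ∧ S₂ ∧ S₃ FEPolymerActivitiesReg (XXL = NODE O proper) ∧ S₄ FEPolymerResummation (M–L)`, cut INSIDE print's cluster half at the
POLYMER-ACTIVITY interface of [II] (2.11) ↔ (2.12)–(2.13) p.14 (the hard-core polymer gas with activities `H(Z)` ↔ its exponentiation ∕ `X`-localisation).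
* §1 — W-format polymer activity systems at level `k`: `feActAt` (the activity `H(Z)` as a function of the torus pair, W-format dispatch: pull-back piece of ONE integer-local formula off
  the wrap class, a free torus piece on it), `fePolyAct` (evaluated on the charted datum), `fePolyLogZ` (the Kotecký–Preiss logarithm of the gas, incompatibility `TTouch`), the hereditary
  rows `ActivityRowsW` ([II] p.15 L4–11, Lemma 3 (2.38)), and the Π-rep rows `PolymerRepOnRegW` (`Φ n B = log Ξ(B) − log Ξ(0)` on the ε₀-class, (2.12)).
* §2 — the candidate letters S₁, S₂, S₃, S₄ as `def … : Prop` (the tree's LETTER convention of ✓`FEStepReg`: ★ ∕ OPEN ∕ inhabited nowhere ∕ `[cite …]`; D-0026: candidate letters of a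
  crux split, NOT facts, asserted for nothing).  S₂ = the sketch's `RegClassNestsUc` VERBATIM = the (α) edition of ▶ PT-A's antecedent-free ✓`ClassNestsUc` (`…PortS1ClassRegDefs` :71)
  UNDER the ⁸ antecedent (★★★ №635 (t5) antecedent placement, №636 (1) un-merge: the registry's S₂ stub DISPLAYS [15] Thm 1 instead of proving it); the stronger letter implies it
  (`regClassNestsUc_of_classNestsUc`, via ✓`inRegClass_mono` — the ε₀-class grows with `ε₀`); ▶ PT-A's LZ brick imports `RegClassNestsUc` from HERE.
* §3 — ★★★ `feStepReg_of_polymerPieces : (∀F, P0HolExtAtRecordGL F) → (∀F, FEChartLawReg F) → (∀F, RegClassNestsUc F) → (∀F, FEPolymerActivitiesReg F) → (∀F, FEPolymerResummation F) → ∀F, FEStepReg F`,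
  SORRY-FREE — the sketch's glue VERBATIM, kernel-checked against `FEStepReg`'s text (`Mth := max (max M₁ M₂) M₃`; εp ← S₁, ε₂₉ ← S₃ under εp, εc ← S₁, εn ← S₂, S₃ at `εcap := min εc εn`; the (f′)-Reg row transported
  to `phiFE` along S₁'s class identity; the ε₀-regularity of `B = 0` is ✓`eventually_inRegClass` at the antecedent's `hP9` ∕ `hTE`).
SIZES ∕ HONEST LOCATION MAP (№634 (1)): the wall is UNMOVED — S₃ ⊇ [II] Lemmas 1–3 at the record + the `TwoTorusStep` pin; what moved is location: XXL `stub_FEstepReg` = XL S₁ + M S₂ +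
M–L S₄ (takeable now: `B13Resummation` + `TreeLengthTorusGeometry.tgeometry` + `ClusterExpansion.exp_polymerLogZ_of_kp`) + XXL S₃.  vs ✓`FEStepReg`: S₁, S₂ genuinely weaker print
consequences; S₃ — neither implies the other, not a restatement (◆'s wording).

HONEST FRAMING.  Definitions (5 objects ∕ row-predicates + 4 candidate letters) and conditional bookkeeping theorems; NOTHING of Bałaban's (1.4)–(1.7) ∕ Thm 3 ∕ §2–§5 ∕ [II] is asserted,
ported or discharged; `FEStepReg` ∕ `FEChartLawReg` ∕ `RegClassNestsUc` ∕ `ClassNestsUc` ∕ `FEPolymerActivitiesReg` ∕ `FEPolymerResummation` are inhabited NOWHERE; `stub_FEstepReg` ∕ `stub_P0C` ∕ `stub_LZhalfReg`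
OPEN, ⟨27930⟩ OPEN (v3.7; a v3.8 re-registration is the lead's act on ★★★'s word, not this file's); K0ᴬ ∕ K1ᴬ ∕ K3ᴬ OPEN; NODE O 0∕1; COUNT 8∕28 · K 1∕4 UNMOVED; finite `𝕋⁴_{L^K}` at fixed ε —
NOT continuum ∕ ℝ⁴ ∕ OS; **the Yang–Mills mass gap (Clay) is NOT proved by any of this.**  No `sorry`, `instance`, `notation`; standard axioms.
-/

noncomputable section

open scoped BigOperators Matrix.Norms.L2Operator Topology

namespace Summit.QuantumFields.YangMills.Theorems.BalabanUVNodesPortS1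

open Summit.QuantumFields.YangMills.Theorems.K0RecordFormatNames
open Literature.MathematicalPhysics.QuantumFieldTheory.Balaban1983to89
open Literature.MathematicalPhysics.QuantumFieldTheory.Balaban1983to89.Node00
open Literature.MathematicalPhysics.QuantumFieldTheory.Balaban1983to89.T4Continuum (T4Family)
open Literature.MathematicalPhysics.QuantumFieldTheory.Balaban1983to89.TreeLengthTorusGeometry (TTouch)
open Literature.Probability.LatticeModels (polymerLogZ)
open _root_.Filter


/-! ## §1  W-format polymer activity systems at level `k` ([II] (2.11) p.14 at the record) -/

open scoped Classical in
/-- **The activity `H(Z)` of the polymer `Z ∈ 𝐃_{k+1}(T_{K₀+n})` AS A FUNCTION OF THE PAIR `(𝐔, 𝐉)` ON THE TORUS, W-FORMAT DISPATCH**: off the wrap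
class the pull-back piece `Hi.Ψ.piece … Z ψ = Hi.Ψ (X̂(Z)) (ψ ∘ cover)` of ONE integer-local formula `Hi`, on the wrap class a free torus piece `Hw n Z ψ`
— the summand format of ✓`IntFormula.RepresentsW` with activities in place of (1.7)-terms. [cite: Balaban1988RG2Cluster, (2.9)–(2.11) p.14; Balaban1987RG1, (1.7) p.261, (1.21) p.264] -/
def feActAt (F : T4Family) (Mc k : ℕ) (Hi : IntLocalFormula (F.L ^ (k + 1) * Mc)) (Hw : TorusPieces F Mc k) (n : ℕ)
    (Z : (recordDomSys F Mc k (recordK₀ F Mc k + n)).Dom) (ψ : Sect2.CPair (F.P (recordK₀ F Mc k + n)) (MatA 2)) : ℂ :=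
  if Z ∈ recordWrapCtr F Mc k (recordK₀ F Mc k + n) then Hw n Z ψ else Hi.Ψ.piece F Mc k (recordK₀ F Mc k + n) Z ψ

/-- **The activity `H(Z)` EVALUATED ON THE CHARTED DATUM `B`**: `feActAt` at the (1.9) pair of `U_{k+1}(W_B)` cut to `Z` (`pairCutTorusAt`; its pull-back is
`pairCutAt`, ✓`pairCutAt_eq_pullPair` below, `rfl`). [cite: Balaban1988RG2Cluster, (2.11) p.14; Balaban1987RG1, (1.8)–(1.9) p.261] -/
def fePolyAct (F : T4Family) (Mc k : ℕ) (a₀ ε₂₉ : ℝ) (Hi : IntLocalFormula (F.L ^ (k + 1) * Mc)) (Hw : TorusPieces F Mc k) (n : ℕ)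
    (B : recordW F a₀ ε₂₉ k (recordK₀ F Mc k + n)) (Z : (recordDomSys F Mc k (recordK₀ F Mc k + n)).Dom) : ℂ :=
  feActAt F Mc k Hi Hw n Z (pairCutTorusAt F a₀ ε₂₉ Mc k (recordK₀ F Mc k + n) Z B)

/-- Bookkeeping check (porter detail): the integer (f′) integrand IS the pull-back of the torus cut pair, definitionally. -/
theorem pairCutAt_eq_pullPair (F : T4Family) (a₀ ε₂₉ : ℝ) (Mc k K : ℕ) (X : (recordDomSys F Mc k K).Dom) (B : recordW F a₀ ε₂₉ k K) :
    pairCutAt F a₀ ε₂₉ Mc k K X B = pullPair F K (pairCutTorusAt F a₀ ε₂₉ Mc k K X B) := rfl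

open scoped Classical in
/-- **The Kotecký–Preiss logarithm `log Ξ` of the hard-core polymer gas (2.11) on the charted datum** — polymers = the domains of
`𝐃_{k+1}(T_{K₀+n})`, incompatibility = `TTouch` («ζ(Z, Z′) = 0 if Z ∩ Z′ contains a cube, or a wall of a cube»), activities `fePolyAct`.
[cite: Balaban1988RG2Cluster, (2.11)–(2.12) p.14; KoteckyPreiss1986, Thm p.492] -/
def fePolyLogZ (F : T4Family) (Mc k : ℕ) (a₀ ε₂₉ : ℝ) (Hi : IntLocalFormula (F.L ^ (k + 1) * Mc)) (Hw : TorusPieces F Mc k) (n : ℕ)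
    (B : recordW F a₀ ε₂₉ k (recordK₀ F Mc k + n)) : ℂ :=
  polymerLogZ TTouch (fePolyAct F Mc k a₀ ε₂₉ Hi Hw n B) Finset.univ

/-- **HEREDITARY ACTIVITY ROWS at `(α₀, α₁; A, R)`** — print-faithful [II] p.15 L4–11 («Z̃₀ ⊂ Z ⊂ X for the activities in (2.13) … the activities in (2.13),
and the whole sum E^{(k+1)}(X), are analytic functions of (U, J), on the space U^c_{k+1}(X, α₀, α₁)») and Lemma 3 (2.38): for every domain `X`, every
polymer `Z ⊆ X` and every pair `φ` in `U^c_{k+1}(X, α₀, α₁)` OF RECORD, the activity `feActAt n Z` is analytic at `φ` and KP-small in the (1.18)-shape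
`‖H(Z)(φ)‖ ≤ A e^{−R d_{k+1}(Z)}`.  (Hereditary in `X ⊇ Z` BY DESIGN: the resummed pieces `E^{(k+1)}(X)` must be analytic on `U^c(X)`, and no antitonicity
`U^c(X) ⊆ U^c(Z)` of ✓`recordUc` — the tree's abstract HYPOTHESIS `B13Resummation.SpRestr` — is asked of anybody.)
[cite: Balaban1988RG2Cluster, p.15 L4–11, Lemma 3 (2.38) p.20; Balaban1987RG1, (1.11)–(1.16) pp.262–263, (1.18) p.263] -/
def ActivityRowsW (F : T4Family) (Mc k : ℕ) (Hi : IntLocalFormula (F.L ^ (k + 1) * Mc)) (Hw : TorusPieces F Mc k) (α₀ α₁ A R : ℝ) : Prop :=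
  ∀ n (X Z : (recordDomSys F Mc k (recordK₀ F Mc k + n)).Dom), (Z.1 : Finset _) ⊆ (X.1 : Finset _) →
    ∀ φ : Sect2.CPair (F.P (recordK₀ F Mc k + n)) (MatA 2),
      encodeCfg F (recordK₀ F Mc k + n) φ ∈ recordUc F Mc k α₀ α₁ (recordK₀ F Mc k + n) X →
        AnalyticAt ℂ (feActAt F Mc k Hi Hw n Z) φ ∧
          ‖feActAt F Mc k Hi Hw n Z φ‖ ≤ A * Real.exp (-(R * (recordDomSys F Mc k (recordK₀ F Mc k + n)).dj Z))

/-- ★ **Π-rep ROWS — a functional family `Φ` IS THE KP-LOGARITHM OF A W-FORMAT POLYMER GAS ON THE ε₀-CLASS**: the activity system `(Hi, Hw)` has the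
hereditary rows `ActivityRowsW … α₀ α₁ A R` (Lemmas 1–3 of [II] at the record: analytic on `U^c_{k+1}(X, α₀, α₁)` for `Z ⊆ X`, KP-small in the
(1.18)-shape `|H(Z)| ≤ A e^{−R d_{k+1}(Z)}`), the wrap activities are (1.7)-local and (1.19)-invariant (✓`LocalOnW`, ✓`GaugeInvOnW` — off the wrap class
both are STRUCTURE of `Hi : IntLocalFormula`), and for every ε₀-regular `B`: `Φ n B = log Ξ(B) − log Ξ(0)` ((2.12): «if the activities H(Z) … are sufficiently
small, then the polymer expansion can be exponentiated according to the well-known formula, see [36, 60, 26, 25, 67, 50]»; the subtraction is print's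
normalisation «minus its value at U_{k+1} = 1», [I] (2.13)–(2.14) p.268).
[cite: Balaban1988RG2Cluster, (2.11)–(2.13) p.14, p.15 L4–11, Lemma 3 (2.38) p.20, p.21 L33–40; Balaban1987RG1, (1.7) p.261, (1.18)–(1.19) p.263, (2.13)–(2.14) p.268] -/
def PolymerRepOnRegW (F : T4Family) (Mc k : ℕ) (Hi : IntLocalFormula (F.L ^ (k + 1) * Mc)) (Hw : TorusPieces F Mc k)
    (a₀ ε₂₉ α₀ α₁ ε₀ A R : ℝ) (Φf : (n : ℕ) → recordW F a₀ ε₂₉ k (recordK₀ F Mc k + n) → ℂ) : Prop :=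
  ActivityRowsW F Mc k Hi Hw α₀ α₁ A R ∧ Hw.LocalOnW F ∧ Hw.GaugeInvOnW F ∧
    ∀ n (B : recordW F a₀ ε₂₉ k (recordK₀ F Mc k + n)), InRegClass F Mc k ε₀ a₀ ε₂₉ n B →
      letI θ := thetaFill F a₀ ε₂₉; letI := θ.instVβ₁; letI := θ.instVβ₂; letI := θ.instιβ
      Φf n B = fePolyLogZ F Mc k a₀ ε₂₉ Hi Hw n B - fePolyLogZ F Mc k a₀ ε₂₉ Hi Hw n 0

/-! ## §2  The four candidate letters (OPEN, inhabited nowhere) -/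

/-- ★★ **S₁ `FEChartLawReg F` — FE-1, ε₀-CLASS EDITION (XL)**: ✓`FEChartLawStep` with the LZ package∕IH read in the Reg currency and «eventually at
`B = 0`» replaced by «at every ε₀-regular `B`, `ε₀ ≤ εc`»: `phiFE = feFluctDiff` on `U_k(ε₀)` — print's (2.1) ↦ (2.12) second bracket = (2.13) minus its
value at `U_{k+1} = 1`.  Vs ✓`FEStepReg`: a genuinely WEAKER print consequence.  OPEN (XL); inhabited nowhere; a CANDIDATE letter of the №634 sub-split (D-0026: not a fact; asserted for nothing).
[cite: Balaban1987RG1, (2.1)–(2.9) pp.265–266, (2.10)–(2.14) pp.267–268, (1.2) p.260] -/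
def FEChartLawReg (F : T4Family) : Prop :=
  ∃ Mth : ℕ, ∀ Mc : ℕ, Mth ≤ Mc → ∀ (j c c₀ c₁ : ℕ) (B₃ B₃' a₀ a₁ : ℝ), Summit.QuantumFields.YangMills.Theorems.K0RecordFormatNames.McGuard F Mc → c ≤ F.L ^ j → c₀ ≤ j + 1 → c₁ ≤ j → 2 * (F.L : ℝ) ^ 2 ≤ B₃ → 0 < B₃' → 0 < a₀ → 0 < a₁ → Literature.MathematicalPhysics.QuantumFieldTheory.Balaban1983to89.Node00.VariationalThm1RegSepCoP7MGB F 2 (fun ν M g K k _s => c ≤ ν.M₁ ∧ k + c₀ ≤ F.m + K ∧ F.L ^ c₁ ∣ M ∧ ∀ i, 1 ≤ i → i ≤ k → Literature.MathematicalPhysics.QuantumFieldTheory.Balaban1983to89.Node00.dCubeSide (F.P K).L M (Literature.MathematicalPhysics.QuantumFieldTheory.Balaban1983to89.Node00.RkOfRecord (F.P K).L ν.r (g i)) i ∣ (F.P K).sitesPerDir 0) (Literature.MathematicalPhysics.QuantumFieldTheory.Balaban1983to89.Node00.lamDatum F) (Literature.MathematicalPhysics.QuantumFieldTheory.Balaban1983to89.Node00.dataSmall7LamTopOf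 F 2) B₃ a₀ a₁ → Literature.MathematicalPhysics.QuantumFieldTheory.Balaban1983to89.Node00.Gauge9RegSepTopStepGB F 2 (fun ν K Ω => Literature.MathematicalPhysics.QuantumFieldTheory.Balaban1983to89.Node00.suppDomOfRecord F ν K Ω) (F.L ^ j) (fun ν M g K k _s => c ≤ ν.M₁ ∧ k + c₀ ≤ F.m + K ∧ F.L ^ c₁ ∣ M ∧ ∀ i, 1 ≤ i → i ≤ k → Literature.MathematicalPhysics.QuantumFieldTheory.Balaban1983to89.Node00.dCubeSide (F.P K).L M (Literature.MathematicalPhysics.QuantumFieldTheory.Balaban1983to89.Node00.RkOfRecord (F.P K).L ν.r (g i)) i ∣ (F.P K).sitesPerDir 0) (Literature.MathematicalPhysics.QuantumFieldTheory.Balaban1983to89.Node00.lamDatum F) (Literature.MathematicalPhysics.QuantumFieldTheory.Balaban1983to89.Node00.dataSmall7LamTopOf F 2) B₃ B₃' a₀ a₁ → (∀ ε₁ : ℝ, 0 < ε₁ → ε₁ ≤ a₁ → B₃ * ε₁ ≤ a₀ → ∀ (k n : ℕ) (V : Literature.MathematicalPhysics.QuantumFieldTheory.Balaban1983to89.GaugeField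 (F.P (Summit.QuantumFields.YangMills.Theorems.K0RecordFormatNames.recordK₀ F Mc k + n)) (k + 1) (Literature.MathematicalPhysics.QuantumFieldTheory.Balaban1983to89.Node00.SU 2)), Literature.MathematicalPhysics.QuantumFieldTheory.Balaban1983to89.PlaqSmall ε₁ V → Literature.MathematicalPhysics.QuantumFieldTheory.Balaban1983to89.Node00.UkExists F 2 (Summit.QuantumFields.YangMills.Theorems.K0RecordFormatNames.recordK₀ F Mc k + n) (k + 1) a₀ V ∧ Literature.MathematicalPhysics.QuantumFieldTheory.Balaban1983to89.Node00.UniqueUkOrbit F 2 (Summit.QuantumFields.YangMills.Theorems.K0RecordFormatNames.recordK₀ F Mc k + n) (k + 1) a₀ V) → (∀ (k n : ℕ) (ε₂₉ : ℝ), 0 < ε₂₉ → letI θ := Summit.QuantumFields.YangMills.Theorems.K0RecordFormatNames.thetaFill F a₀ ε₂₉; letI := θ.instVβ₁; letI := θ.instVβ₂; letI := θ.instιβ; AnalyticAt ℝ (fun B : Summit.QuantumFields.YangMills.Theorems.K0RecordFormatNames.recordW F a₀ ε₂₉ k (Summit.QuantumFields.YangMills.Theorems.K0RecordFormatNames.recordK₀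 F Mc k + n) => fun (b : Literature.MathematicalPhysics.QuantumFieldTheory.Balaban1983to89.PBond (F.P (Summit.QuantumFields.YangMills.Theorems.K0RecordFormatNames.recordK₀ F Mc k + n)) 0) (i i' : Fin 2) => ((Summit.QuantumFields.YangMills.Theorems.K0RecordFormatNames.recordBgField F θ k (Summit.QuantumFields.YangMills.Theorems.K0RecordFormatNames.recordK₀ F Mc k + n) B b : Literature.MathematicalPhysics.QuantumFieldTheory.Balaban1983to89.Node00.SU 2) : Matrix (Fin 2) (Fin 2) ℂ) i i') 0) → (∃ C₉' δ₉ : ℝ, 0 ≤ C₉' ∧ 0 < δ₉ ∧ ∀ (k n : ℕ) (ε₂₉ : ℝ), 0 < ε₂₉ → letI θ := Summit.QuantumFields.YangMills.Theorems.K0RecordFormatNames.thetaFill F a₀ ε₂₉; letI := θ.instVβ₁; letI := θ.instVβ₂; letI := θ.instιβ; ∀ (a : θ.ιβ) (μ : Fin (F.P (Summit.QuantumFields.YangMills.Theorems.K0RecordFormatNames.recordK₀ F Mc k + n)).d) (y : Literature.MathematicalPhysics.QuantumFieldTheory.Balaban1983to89.Site (F.P (Summit.QuantumFields.YangMills.Theorems.K0RecordFormatNames.recordK₀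 F Mc k + n)) (k + 1)), letI D := fderiv ℝ (fun B : Summit.QuantumFields.YangMills.Theorems.K0RecordFormatNames.recordW F a₀ ε₂₉ k (Summit.QuantumFields.YangMills.Theorems.K0RecordFormatNames.recordK₀ F Mc k + n) => fun (b : Literature.MathematicalPhysics.QuantumFieldTheory.Balaban1983to89.PBond (F.P (Summit.QuantumFields.YangMills.Theorems.K0RecordFormatNames.recordK₀ F Mc k + n)) 0) (i i' : Fin 2) => ((Summit.QuantumFields.YangMills.Theorems.K0RecordFormatNames.recordBgField F θ k (Summit.QuantumFields.YangMills.Theorems.K0RecordFormatNames.recordK₀ F Mc k + n) B b : Literature.MathematicalPhysics.QuantumFieldTheory.Balaban1983to89.Node00.SU 2) : Matrix (Fin 2) (Fin 2) ℂ) i i') 0 (Pi.single μ (Pi.single y (θ.bV a))); ∃ (Hr : Literature.MathematicalPhysics.QuantumFieldTheory.Balaban1983to89.PBond (F.P (Summit.QuantumFields.YangMills.Theorems.K0RecordFormatNames.recordK₀ F Mc k + n)) 0 → Fin 2 → Fin 2 → ℂ) (φ : Literature.MathematicalPhysics.QuantumFieldTheory.Balaban1983to89.Site (F.P (Summit.QuantumFields.YangMills.Theorems.K0RecordFormatNames.recordK₀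 F Mc k + n)) 0 → Fin 2 → Fin 2 → ℂ), (∀ b : Literature.MathematicalPhysics.QuantumFieldTheory.Balaban1983to89.PBond (F.P (Summit.QuantumFields.YangMills.Theorems.K0RecordFormatNames.recordK₀ F Mc k + n)) 0, D b = Hr b + (φ b.src - φ (b.src.shift b.dir))) ∧ (∃ μc : Literature.MathematicalPhysics.QuantumFieldTheory.Balaban1983to89.Site (F.P (Summit.QuantumFields.YangMills.Theorems.K0RecordFormatNames.recordK₀ F Mc k + n)) (k + 1) → Fin 2 → Fin 2 → ℂ, ∀ x : Literature.MathematicalPhysics.QuantumFieldTheory.Balaban1983to89.Site (F.P (Summit.QuantumFields.YangMills.Theorems.K0RecordFormatNames.recordK₀ F Mc k + n)) 0, letI dv := (fun x' : Literature.MathematicalPhysics.QuantumFieldTheory.Balaban1983to89.Site (F.P (Summit.QuantumFields.YangMills.Theorems.K0RecordFormatNames.recordK₀ F Mc k + n)) 0 => ∑ ν : Fin (F.P (Summit.QuantumFields.YangMills.Theorems.K0RecordFormatNames.recordK₀ F Mc k + n)).d, (Hr ⟨x', ν⟩ - Hr ⟨x'.unshift ν, ν⟩)); ∑ ν : Fin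 (F.P (Summit.QuantumFields.YangMills.Theorems.K0RecordFormatNames.recordK₀ F Mc k + n)).d, (dv (x.shift ν) - (2 : ℂ) • dv x + dv (x.unshift ν)) = μc (Summit.QuantumFields.YangMills.Theorems.K0RecordFormatNames.coarsenTo (k + 1) x)) ∧ ∀ b : Literature.MathematicalPhysics.QuantumFieldTheory.Balaban1983to89.PBond (F.P (Summit.QuantumFields.YangMills.Theorems.K0RecordFormatNames.recordK₀ F Mc k + n)) 0, ‖Hr b‖ ≤ C₉' * (F.P (Summit.QuantumFields.YangMills.Theorems.K0RecordFormatNames.recordK₀ F Mc k + n)).eta (k + 1) * Real.exp (-(δ₉ * (Literature.MathematicalPhysics.QuantumFieldTheory.Balaban1983to89.Site.tdist (Summit.QuantumFields.YangMills.Theorems.K0RecordFormatNames.coarsenTo (k + 1) b.src) y : ℝ))) ∧ (∀ ν : Fin (F.P (Summit.QuantumFields.YangMills.Theorems.K0RecordFormatNames.recordK₀ F Mc k + n)).d, ‖Hr (⟨b.src.shift ν, b.dir⟩ : Literature.MathematicalPhysics.QuantumFieldTheory.Balaban1983to89.PBond (F.P (Summit.QuantumFields.YangMills.Theorems.K0RecordFormatNames.recordK₀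 F Mc k + n)) 0) - Hr b‖ ≤ C₉' * (F.P (Summit.QuantumFields.YangMills.Theorems.K0RecordFormatNames.recordK₀ F Mc k + n)).eta (k + 1) ^ 2 * Real.exp (-(δ₉ * (Literature.MathematicalPhysics.QuantumFieldTheory.Balaban1983to89.Site.tdist (Summit.QuantumFields.YangMills.Theorems.K0RecordFormatNames.coarsenTo (k + 1) b.src) y : ℝ)))) ∧ ‖∑ ν : Fin (F.P (Summit.QuantumFields.YangMills.Theorems.K0RecordFormatNames.recordK₀ F Mc k + n)).d, (Hr (⟨b.src.shift ν, b.dir⟩ : Literature.MathematicalPhysics.QuantumFieldTheory.Balaban1983to89.PBond (F.P (Summit.QuantumFields.YangMills.Theorems.K0RecordFormatNames.recordK₀ F Mc k + n)) 0) - (2 : ℂ) • Hr b + Hr (⟨b.src.unshift ν, b.dir⟩ : Literature.MathematicalPhysics.QuantumFieldTheory.Balaban1983to89.PBond (F.P (Summit.QuantumFields.YangMills.Theorems.K0RecordFormatNames.recordK₀ F Mc k + n)) 0))‖ ≤ C₉' * (F.P (Summit.QuantumFields.YangMills.Theorems.K0RecordFormatNames.recordK₀ F Mc k + n)).eta (k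 + 1) ^ 3 * Real.exp (-(δ₉ * (Literature.MathematicalPhysics.QuantumFieldTheory.Balaban1983to89.Site.tdist (Summit.QuantumFields.YangMills.Theorems.K0RecordFormatNames.coarsenTo (k + 1) b.src) y : ℝ))) ∧ ‖∑ ν : Fin (F.P (Summit.QuantumFields.YangMills.Theorems.K0RecordFormatNames.recordK₀ F Mc k + n)).d, ((Hr (⟨b.src, b.dir⟩ : Literature.MathematicalPhysics.QuantumFieldTheory.Balaban1983to89.PBond (F.P (Summit.QuantumFields.YangMills.Theorems.K0RecordFormatNames.recordK₀ F Mc k + n)) 0) + Hr (⟨(b.src).shift b.dir, ν⟩ : Literature.MathematicalPhysics.QuantumFieldTheory.Balaban1983to89.PBond (F.P (Summit.QuantumFields.YangMills.Theorems.K0RecordFormatNames.recordK₀ F Mc k + n)) 0) - Hr (⟨(b.src).shift ν, b.dir⟩ : Literature.MathematicalPhysics.QuantumFieldTheory.Balaban1983to89.PBond (F.P (Summit.QuantumFields.YangMills.Theorems.K0RecordFormatNames.recordK₀ F Mc k + n)) 0) - Hr (⟨b.src, ν⟩ : Literature.MathematicalPhysics.QuantumFieldTheory.Balaban1983to89.PBond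 (F.P (Summit.QuantumFields.YangMills.Theorems.K0RecordFormatNames.recordK₀ F Mc k + n)) 0)) - (Hr (⟨b.src.unshift ν, b.dir⟩ : Literature.MathematicalPhysics.QuantumFieldTheory.Balaban1983to89.PBond (F.P (Summit.QuantumFields.YangMills.Theorems.K0RecordFormatNames.recordK₀ F Mc k + n)) 0) + Hr (⟨(b.src.unshift ν).shift b.dir, ν⟩ : Literature.MathematicalPhysics.QuantumFieldTheory.Balaban1983to89.PBond (F.P (Summit.QuantumFields.YangMills.Theorems.K0RecordFormatNames.recordK₀ F Mc k + n)) 0) - Hr (⟨(b.src.unshift ν).shift ν, b.dir⟩ : Literature.MathematicalPhysics.QuantumFieldTheory.Balaban1983to89.PBond (F.P (Summit.QuantumFields.YangMills.Theorems.K0RecordFormatNames.recordK₀ F Mc k + n)) 0) - Hr (⟨b.src.unshift ν, ν⟩ : Literature.MathematicalPhysics.QuantumFieldTheory.Balaban1983to89.PBond (F.P (Summit.QuantumFields.YangMills.Theorems.K0RecordFormatNames.recordK₀ F Mc k + n)) 0)))‖ ≤ C₉' * (F.P (Summit.QuantumFields.YangMills.Theorems.K0RecordFormatNames.recordK₀ F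 Mc k + n)).eta (k + 1) ^ 3 * Real.exp (-(δ₉ * (Literature.MathematicalPhysics.QuantumFieldTheory.Balaban1983to89.Site.tdist (Summit.QuantumFields.YangMills.Theorems.K0RecordFormatNames.coarsenTo (k + 1) b.src) y : ℝ)))) → Summit.QuantumFields.YangMills.Theorems.K0RecordFormatNames.P0HolExtAtRecordGL F → ∃ εp : ℝ, 0 < εp ∧ ∀ ε₂₉ : ℝ, 0 < ε₂₉ → ε₂₉ ≤ εp → ∃ εc : ℝ, 0 < εc ∧ ∀ (E₁ κ₁ β₀ β₁ δ₀ : ℝ), 0 ≤ E₁ → 4 * Literature.MathematicalPhysics.QuantumFieldTheory.Balaban1983to89.B12TreeDecay.kappa₀ (4 * 2 ^ 4) (2 * 4) ≤ κ₁ → 0 < β₀ → 0 < β₁ → 0 < δ₀ → (∀ k : ℕ, Summit.QuantumFields.YangMills.Theorems.BalabanUVNodesPortS1.LZResidueRegAt F Mc a₀ ε₂₉ β₀ β₁ δ₀ E₁ κ₁ k) → ∀ (γ₀ E₂ κ α₀ α₁ ε₀ : ℝ), 0 < γ₀ → 0 ≤ E₂ → 4 * Literature.MathematicalPhysics.QuantumFieldTheory.Balaban1983to89.B12TreeDecay.kappa₀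 (4 * 2 ^ 4) (2 * 4) ≤ κ → 0 < α₀ → 0 < α₁ → 0 < ε₀ → ε₀ ≤ εc → ∀ k : ℕ, (∀ j : ℕ, j < k → Summit.QuantumFields.YangMills.Theorems.BalabanUVNodesPortS1.FEResidueRegBoxAt F Mc a₀ ε₂₉ γ₀ α₀ α₁ ε₀ E₂ κ j) → ∀ v : Fin (k + 1) → ℝ, v ∈ Literature.MathematicalPhysics.QuantumFieldTheory.Balaban1983to89.FlowStep.Box γ₀ k → ∀ (n : ℕ) (B : Summit.QuantumFields.YangMills.Theorems.K0RecordFormatNames.recordW F a₀ ε₂₉ k (Summit.QuantumFields.YangMills.Theorems.K0RecordFormatNames.recordK₀ F Mc k + n)), Summit.QuantumFields.YangMills.Theorems.K0RecordFormatNames.InRegClass F Mc k ε₀ a₀ ε₂₉ n B → Summit.QuantumFields.YangMills.Theorems.BalabanUVNodesPortS1.phiFE F Mc a₀ ε₂₉ k v n B = Summit.QuantumFields.YangMills.Theorems.BalabanUVNodesPortS1.feFluctDiff F Mc a₀ ε₂₉ k v n B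

/-- ★★ **S₂ `RegClassNestsUc F` — THE NESTING BRICK (M)**: under the ⁸ antecedent, for every `(ε₂₉, α₀, α₁)` a k-UNIFORM class radius `εn` below which
every CUT pair of an ε₀-regular charted datum lies in `U^c_{k+1}(X, α₀, α₁)` of record, for every domain `X` and every volume — print's «U_k(ε₀) ⊂ U^c_j(X, α₀, α₁)
for ε₀ sufficiently small» (the `hnest` interface of ✓`representsOnRegW_of_onUc_of_nesting`; class sibling of the THEOREM ✓`cutsInUcNear_holds`).
≡ the (α) edition of ▶ PT-A's ✓`ClassNestsUc` (`…PortS1ClassRegDefs` :71) UNDER the ⁸ antecedent (★★★ №635 (t5) antecedent placement; №636 (1) un-merge): the antecedent-free letter is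
STRONGER and implies this one (`regClassNestsUc_of_classNestsUc` below, via ✓`inRegClass_mono`).  OPEN (M); inhabited nowhere; a CANDIDATE letter of the №634 sub-split (D-0026: not a fact;
asserted for nothing). [cite: Balaban1987RG1, p.263 L5–20, (1.11)–(1.16) pp.262–263; Balaban1985Variational, Prop. 9 p.309] -/
def RegClassNestsUc (F : T4Family) : Prop :=
  ∃ Mth : ℕ, ∀ Mc : ℕ, Mth ≤ Mc → ∀ (j c c₀ c₁ : ℕ) (B₃ B₃' a₀ a₁ : ℝ), Summit.QuantumFields.YangMills.Theorems.K0RecordFormatNames.McGuard F Mc → c ≤ F.L ^ j → c₀ ≤ j + 1 → c₁ ≤ j → 2 * (F.L : ℝ) ^ 2 ≤ B₃ → 0 < B₃' → 0 < a₀ → 0 < a₁ → Literature.MathematicalPhysics.QuantumFieldTheory.Balaban1983to89.Node00.VariationalThm1RegSepCoP7MGB F 2 (fun ν M g K k _s => c ≤ ν.M₁ ∧ k + c₀ ≤ F.m + K ∧ F.L ^ c₁ ∣ M ∧ ∀ i, 1 ≤ i → i ≤ k → Literature.MathematicalPhysics.QuantumFieldTheory.Balaban1983to89.Node00.dCubeSide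 (F.P K).L M (Literature.MathematicalPhysics.QuantumFieldTheory.Balaban1983to89.Node00.RkOfRecord (F.P K).L ν.r (g i)) i ∣ (F.P K).sitesPerDir 0) (Literature.MathematicalPhysics.QuantumFieldTheory.Balaban1983to89.Node00.lamDatum F) (Literature.MathematicalPhysics.QuantumFieldTheory.Balaban1983to89.Node00.dataSmall7LamTopOf F 2) B₃ a₀ a₁ → Literature.MathematicalPhysics.QuantumFieldTheory.Balaban1983to89.Node00.Gauge9RegSepTopStepGB F 2 (fun ν K Ω => Literature.MathematicalPhysics.QuantumFieldTheory.Balaban1983to89.Node00.suppDomOfRecord F ν K Ω) (F.L ^ j) (fun ν M g K k _s => c ≤ ν.M₁ ∧ k + c₀ ≤ F.m + K ∧ F.L ^ c₁ ∣ M ∧ ∀ i, 1 ≤ i → i ≤ k → Literature.MathematicalPhysics.QuantumFieldTheory.Balaban1983to89.Node00.dCubeSide (F.P K).L M (Literature.MathematicalPhysics.QuantumFieldTheory.Balaban1983to89.Node00.RkOfRecord (F.P K).L ν.r (g i)) i ∣ (F.P K).sitesPerDir 0) (Literature.MathematicalPhysics.QuantumFieldTheory.Balaban1983to89.Node00.lamDatum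 F) (Literature.MathematicalPhysics.QuantumFieldTheory.Balaban1983to89.Node00.dataSmall7LamTopOf F 2) B₃ B₃' a₀ a₁ → (∀ ε₁ : ℝ, 0 < ε₁ → ε₁ ≤ a₁ → B₃ * ε₁ ≤ a₀ → ∀ (k n : ℕ) (V : Literature.MathematicalPhysics.QuantumFieldTheory.Balaban1983to89.GaugeField (F.P (Summit.QuantumFields.YangMills.Theorems.K0RecordFormatNames.recordK₀ F Mc k + n)) (k + 1) (Literature.MathematicalPhysics.QuantumFieldTheory.Balaban1983to89.Node00.SU 2)), Literature.MathematicalPhysics.QuantumFieldTheory.Balaban1983to89.PlaqSmall ε₁ V → Literature.MathematicalPhysics.QuantumFieldTheory.Balaban1983to89.Node00.UkExists F 2 (Summit.QuantumFields.YangMills.Theorems.K0RecordFormatNames.recordK₀ F Mc k + n) (k + 1) a₀ V ∧ Literature.MathematicalPhysics.QuantumFieldTheory.Balaban1983to89.Node00.UniqueUkOrbit F 2 (Summit.QuantumFields.YangMills.Theorems.K0RecordFormatNames.recordK₀ F Mc k + n) (k + 1) a₀ V) → (∀ (k n : ℕ) (ε₂₉ : ℝ), 0 < ε₂₉ → letI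 θ := Summit.QuantumFields.YangMills.Theorems.K0RecordFormatNames.thetaFill F a₀ ε₂₉; letI := θ.instVβ₁; letI := θ.instVβ₂; letI := θ.instιβ; AnalyticAt ℝ (fun B : Summit.QuantumFields.YangMills.Theorems.K0RecordFormatNames.recordW F a₀ ε₂₉ k (Summit.QuantumFields.YangMills.Theorems.K0RecordFormatNames.recordK₀ F Mc k + n) => fun (b : Literature.MathematicalPhysics.QuantumFieldTheory.Balaban1983to89.PBond (F.P (Summit.QuantumFields.YangMills.Theorems.K0RecordFormatNames.recordK₀ F Mc k + n)) 0) (i i' : Fin 2) => ((Summit.QuantumFields.YangMills.Theorems.K0RecordFormatNames.recordBgField F θ k (Summit.QuantumFields.YangMills.Theorems.K0RecordFormatNames.recordK₀ F Mc k + n) B b : Literature.MathematicalPhysics.QuantumFieldTheory.Balaban1983to89.Node00.SU 2) : Matrix (Fin 2) (Fin 2) ℂ) i i') 0) → (∃ C₉' δ₉ : ℝ, 0 ≤ C₉' ∧ 0 < δ₉ ∧ ∀ (k n : ℕ) (ε₂₉ : ℝ), 0 < ε₂₉ → letI θ := Summit.QuantumFields.YangMills.Theorems.K0RecordFormatNames.thetaFill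 F a₀ ε₂₉; letI := θ.instVβ₁; letI := θ.instVβ₂; letI := θ.instιβ; ∀ (a : θ.ιβ) (μ : Fin (F.P (Summit.QuantumFields.YangMills.Theorems.K0RecordFormatNames.recordK₀ F Mc k + n)).d) (y : Literature.MathematicalPhysics.QuantumFieldTheory.Balaban1983to89.Site (F.P (Summit.QuantumFields.YangMills.Theorems.K0RecordFormatNames.recordK₀ F Mc k + n)) (k + 1)), letI D := fderiv ℝ (fun B : Summit.QuantumFields.YangMills.Theorems.K0RecordFormatNames.recordW F a₀ ε₂₉ k (Summit.QuantumFields.YangMills.Theorems.K0RecordFormatNames.recordK₀ F Mc k + n) => fun (b : Literature.MathematicalPhysics.QuantumFieldTheory.Balaban1983to89.PBond (F.P (Summit.QuantumFields.YangMills.Theorems.K0RecordFormatNames.recordK₀ F Mc k + n)) 0) (i i' : Fin 2) => ((Summit.QuantumFields.YangMills.Theorems.K0RecordFormatNames.recordBgField F θ k (Summit.QuantumFields.YangMills.Theorems.K0RecordFormatNames.recordK₀ F Mc k + n) B b : Literature.MathematicalPhysics.QuantumFieldTheory.Balaban1983to89.Node00.SU 2) : Matrix (Fin 2) (Fin 2)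 ℂ) i i') 0 (Pi.single μ (Pi.single y (θ.bV a))); ∃ (Hr : Literature.MathematicalPhysics.QuantumFieldTheory.Balaban1983to89.PBond (F.P (Summit.QuantumFields.YangMills.Theorems.K0RecordFormatNames.recordK₀ F Mc k + n)) 0 → Fin 2 → Fin 2 → ℂ) (φ : Literature.MathematicalPhysics.QuantumFieldTheory.Balaban1983to89.Site (F.P (Summit.QuantumFields.YangMills.Theorems.K0RecordFormatNames.recordK₀ F Mc k + n)) 0 → Fin 2 → Fin 2 → ℂ), (∀ b : Literature.MathematicalPhysics.QuantumFieldTheory.Balaban1983to89.PBond (F.P (Summit.QuantumFields.YangMills.Theorems.K0RecordFormatNames.recordK₀ F Mc k + n)) 0, D b = Hr b + (φ b.src - φ (b.src.shift b.dir))) ∧ (∃ μc : Literature.MathematicalPhysics.QuantumFieldTheory.Balaban1983to89.Site (F.P (Summit.QuantumFields.YangMills.Theorems.K0RecordFormatNames.recordK₀ F Mc k + n)) (k + 1) → Fin 2 → Fin 2 → ℂ, ∀ x : Literature.MathematicalPhysics.QuantumFieldTheory.Balaban1983to89.Site (F.P (Summit.QuantumFields.YangMills.Theorems.K0RecordFormatNames.recordK₀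 F Mc k + n)) 0, letI dv := (fun x' : Literature.MathematicalPhysics.QuantumFieldTheory.Balaban1983to89.Site (F.P (Summit.QuantumFields.YangMills.Theorems.K0RecordFormatNames.recordK₀ F Mc k + n)) 0 => ∑ ν : Fin (F.P (Summit.QuantumFields.YangMills.Theorems.K0RecordFormatNames.recordK₀ F Mc k + n)).d, (Hr ⟨x', ν⟩ - Hr ⟨x'.unshift ν, ν⟩)); ∑ ν : Fin (F.P (Summit.QuantumFields.YangMills.Theorems.K0RecordFormatNames.recordK₀ F Mc k + n)).d, (dv (x.shift ν) - (2 : ℂ) • dv x + dv (x.unshift ν)) = μc (Summit.QuantumFields.YangMills.Theorems.K0RecordFormatNames.coarsenTo (k + 1) x)) ∧ ∀ b : Literature.MathematicalPhysics.QuantumFieldTheory.Balaban1983to89.PBond (F.P (Summit.QuantumFields.YangMills.Theorems.K0RecordFormatNames.recordK₀ F Mc k + n)) 0, ‖Hr b‖ ≤ C₉' * (F.P (Summit.QuantumFields.YangMills.Theorems.K0RecordFormatNames.recordK₀ F Mc k + n)).eta (k + 1) * Real.exp (-(δ₉ * (Literature.MathematicalPhysics.QuantumFieldTheory.Balaban1983to89.Site.tdist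 (Summit.QuantumFields.YangMills.Theorems.K0RecordFormatNames.coarsenTo (k + 1) b.src) y : ℝ))) ∧ (∀ ν : Fin (F.P (Summit.QuantumFields.YangMills.Theorems.K0RecordFormatNames.recordK₀ F Mc k + n)).d, ‖Hr (⟨b.src.shift ν, b.dir⟩ : Literature.MathematicalPhysics.QuantumFieldTheory.Balaban1983to89.PBond (F.P (Summit.QuantumFields.YangMills.Theorems.K0RecordFormatNames.recordK₀ F Mc k + n)) 0) - Hr b‖ ≤ C₉' * (F.P (Summit.QuantumFields.YangMills.Theorems.K0RecordFormatNames.recordK₀ F Mc k + n)).eta (k + 1) ^ 2 * Real.exp (-(δ₉ * (Literature.MathematicalPhysics.QuantumFieldTheory.Balaban1983to89.Site.tdist (Summit.QuantumFields.YangMills.Theorems.K0RecordFormatNames.coarsenTo (k + 1) b.src) y : ℝ)))) ∧ ‖∑ ν : Fin (F.P (Summit.QuantumFields.YangMills.Theorems.K0RecordFormatNames.recordK₀ F Mc k + n)).d, (Hr (⟨b.src.shift ν, b.dir⟩ : Literature.MathematicalPhysics.QuantumFieldTheory.Balaban1983to89.PBond (F.P (Summit.QuantumFields.YangMills.Theorems.K0RecordFormatNames.recordK₀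 F Mc k + n)) 0) - (2 : ℂ) • Hr b + Hr (⟨b.src.unshift ν, b.dir⟩ : Literature.MathematicalPhysics.QuantumFieldTheory.Balaban1983to89.PBond (F.P (Summit.QuantumFields.YangMills.Theorems.K0RecordFormatNames.recordK₀ F Mc k + n)) 0))‖ ≤ C₉' * (F.P (Summit.QuantumFields.YangMills.Theorems.K0RecordFormatNames.recordK₀ F Mc k + n)).eta (k + 1) ^ 3 * Real.exp (-(δ₉ * (Literature.MathematicalPhysics.QuantumFieldTheory.Balaban1983to89.Site.tdist (Summit.QuantumFields.YangMills.Theorems.K0RecordFormatNames.coarsenTo (k + 1) b.src) y : ℝ))) ∧ ‖∑ ν : Fin (F.P (Summit.QuantumFields.YangMills.Theorems.K0RecordFormatNames.recordK₀ F Mc k + n)).d, ((Hr (⟨b.src, b.dir⟩ : Literature.MathematicalPhysics.QuantumFieldTheory.Balaban1983to89.PBond (F.P (Summit.QuantumFields.YangMills.Theorems.K0RecordFormatNames.recordK₀ F Mc k + n)) 0) + Hr (⟨(b.src).shift b.dir, ν⟩ : Literature.MathematicalPhysics.QuantumFieldTheory.Balaban1983to89.PBond (F.P (Summit.QuantumFields.YangMills.Theorems.K0RecordFormatNames.recordK₀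 F Mc k + n)) 0) - Hr (⟨(b.src).shift ν, b.dir⟩ : Literature.MathematicalPhysics.QuantumFieldTheory.Balaban1983to89.PBond (F.P (Summit.QuantumFields.YangMills.Theorems.K0RecordFormatNames.recordK₀ F Mc k + n)) 0) - Hr (⟨b.src, ν⟩ : Literature.MathematicalPhysics.QuantumFieldTheory.Balaban1983to89.PBond (F.P (Summit.QuantumFields.YangMills.Theorems.K0RecordFormatNames.recordK₀ F Mc k + n)) 0)) - (Hr (⟨b.src.unshift ν, b.dir⟩ : Literature.MathematicalPhysics.QuantumFieldTheory.Balaban1983to89.PBond (F.P (Summit.QuantumFields.YangMills.Theorems.K0RecordFormatNames.recordK₀ F Mc k + n)) 0) + Hr (⟨(b.src.unshift ν).shift b.dir, ν⟩ : Literature.MathematicalPhysics.QuantumFieldTheory.Balaban1983to89.PBond (F.P (Summit.QuantumFields.YangMills.Theorems.K0RecordFormatNames.recordK₀ F Mc k + n)) 0) - Hr (⟨(b.src.unshift ν).shift ν, b.dir⟩ : Literature.MathematicalPhysics.QuantumFieldTheory.Balaban1983to89.PBond (F.P (Summit.QuantumFields.YangMills.Theorems.K0RecordFormatNames.recordK₀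 F Mc k + n)) 0) - Hr (⟨b.src.unshift ν, ν⟩ : Literature.MathematicalPhysics.QuantumFieldTheory.Balaban1983to89.PBond (F.P (Summit.QuantumFields.YangMills.Theorems.K0RecordFormatNames.recordK₀ F Mc k + n)) 0)))‖ ≤ C₉' * (F.P (Summit.QuantumFields.YangMills.Theorems.K0RecordFormatNames.recordK₀ F Mc k + n)).eta (k + 1) ^ 3 * Real.exp (-(δ₉ * (Literature.MathematicalPhysics.QuantumFieldTheory.Balaban1983to89.Site.tdist (Summit.QuantumFields.YangMills.Theorems.K0RecordFormatNames.coarsenTo (k + 1) b.src) y : ℝ)))) → ∀ (ε₂₉ α₀ α₁ : ℝ), 0 < ε₂₉ → 0 < α₀ → 0 < α₁ → ∃ εn : ℝ, 0 < εn ∧ ∀ ε₀ : ℝ, 0 < ε₀ → ε₀ ≤ εn → ∀ (k n : ℕ) (B : Summit.QuantumFields.YangMills.Theorems.K0RecordFormatNames.recordW F a₀ ε₂₉ k (Summit.QuantumFields.YangMills.Theorems.K0RecordFormatNames.recordK₀ F Mc k + n)), Summit.QuantumFields.YangMills.Theorems.K0RecordFormatNames.InRegClass F Mc k ε₀ a₀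 ε₂₉ n B → Summit.QuantumFields.YangMills.Theorems.K0RecordFormatNames.CutsInUc F Mc k α₀ α₁ a₀ ε₂₉ n B

/-- ★★★ **S₃ `FEPolymerActivitiesReg F` — THE CLUSTER EXPANSION PROPER (XXL; NODE O proper inside)**: under the ⁸ antecedent, for every bound `εp` a (2.9)
radius `ε₂₉ ≤ εp`; for every LZ package (Reg) the analyticity sizes `(α₀, α₁)`; then for every class cap `εcap` k-UNIFORM `(γ₀, ε₀ ≤ εcap, A, R, E₂, κ)`
satisfying the (2.41) numerics of `B13Resummation.norm_locE_le_of_small` at the torus constants (`ν = 9`, `c₁ = 64`, `κ₀ = κ₀(64, 8)`, `K₀ = K₀(64, 8)`,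
`c = 5`, `b = 5κ`), such that at every level `k` the inductive hypothesis at `j < k` yields, for every box history `v`, a W-format activity system
`(Hi, Hw)` with `PolymerRepOnRegW … A R (feFluctDiff … k v)` — [I] §3–§5 (expansion∕localisation of `𝐏^{(k)}` and `{…}`) + [II] §1 (random-walk
letters (1.26)∕(1.34)∕(1.41)) + [II] (2.1)–(2.12), Lemmas 1–3.  Vs ✓`FEStepReg`: NEITHER implies the other (activities, not the resummed residue); NOT a restatement (◆ C36).
OPEN (XXL — the wall, unmoved); inhabited nowhere; a CANDIDATE letter of the №634 sub-split (D-0026: not a fact; asserted for nothing).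
[cite: Balaban1987RG1, §3–§5 pp.269–301, (2.13) p.268; Balaban1988RG2Cluster, (2.11)–(2.12) p.14, (2.38) p.20] -/
def FEPolymerActivitiesReg (F : T4Family) : Prop :=
  ∃ Mth : ℕ, ∀ Mc : ℕ, Mth ≤ Mc → ∀ (j c c₀ c₁ : ℕ) (B₃ B₃' a₀ a₁ : ℝ), Summit.QuantumFields.YangMills.Theorems.K0RecordFormatNames.McGuard F Mc → c ≤ F.L ^ j → c₀ ≤ j + 1 → c₁ ≤ j → 2 * (F.L : ℝ) ^ 2 ≤ B₃ → 0 < B₃' → 0 < a₀ → 0 < a₁ → Literature.MathematicalPhysics.QuantumFieldTheory.Balaban1983to89.Node00.VariationalThm1RegSepCoP7MGB F 2 (fun ν M g K k _s => c ≤ ν.M₁ ∧ k + c₀ ≤ F.m + K ∧ F.L ^ c₁ ∣ M ∧ ∀ i, 1 ≤ i → i ≤ k → Literature.MathematicalPhysics.QuantumFieldTheory.Balaban1983to89.Node00.dCubeSide (F.P K).L M (Literature.MathematicalPhysics.QuantumFieldTheory.Balaban1983to89.Node00.RkOfRecord (F.P K).L ν.r (g i)) i ∣ (F.P K).sitesPerDir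 0) (Literature.MathematicalPhysics.QuantumFieldTheory.Balaban1983to89.Node00.lamDatum F) (Literature.MathematicalPhysics.QuantumFieldTheory.Balaban1983to89.Node00.dataSmall7LamTopOf F 2) B₃ a₀ a₁ → Literature.MathematicalPhysics.QuantumFieldTheory.Balaban1983to89.Node00.Gauge9RegSepTopStepGB F 2 (fun ν K Ω => Literature.MathematicalPhysics.QuantumFieldTheory.Balaban1983to89.Node00.suppDomOfRecord F ν K Ω) (F.L ^ j) (fun ν M g K k _s => c ≤ ν.M₁ ∧ k + c₀ ≤ F.m + K ∧ F.L ^ c₁ ∣ M ∧ ∀ i, 1 ≤ i → i ≤ k → Literature.MathematicalPhysics.QuantumFieldTheory.Balaban1983to89.Node00.dCubeSide (F.P K).L M (Literature.MathematicalPhysics.QuantumFieldTheory.Balaban1983to89.Node00.RkOfRecord (F.P K).L ν.r (g i)) i ∣ (F.P K).sitesPerDir 0) (Literature.MathematicalPhysics.QuantumFieldTheory.Balaban1983to89.Node00.lamDatum F) (Literature.MathematicalPhysics.QuantumFieldTheory.Balaban1983to89.Node00.dataSmall7LamTopOf F 2) B₃ B₃' a₀ a₁ → (∀ ε₁ : ℝ,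 0 < ε₁ → ε₁ ≤ a₁ → B₃ * ε₁ ≤ a₀ → ∀ (k n : ℕ) (V : Literature.MathematicalPhysics.QuantumFieldTheory.Balaban1983to89.GaugeField (F.P (Summit.QuantumFields.YangMills.Theorems.K0RecordFormatNames.recordK₀ F Mc k + n)) (k + 1) (Literature.MathematicalPhysics.QuantumFieldTheory.Balaban1983to89.Node00.SU 2)), Literature.MathematicalPhysics.QuantumFieldTheory.Balaban1983to89.PlaqSmall ε₁ V → Literature.MathematicalPhysics.QuantumFieldTheory.Balaban1983to89.Node00.UkExists F 2 (Summit.QuantumFields.YangMills.Theorems.K0RecordFormatNames.recordK₀ F Mc k + n) (k + 1) a₀ V ∧ Literature.MathematicalPhysics.QuantumFieldTheory.Balaban1983to89.Node00.UniqueUkOrbit F 2 (Summit.QuantumFields.YangMills.Theorems.K0RecordFormatNames.recordK₀ F Mc k + n) (k + 1) a₀ V) → (∀ (k n : ℕ) (ε₂₉ : ℝ), 0 < ε₂₉ → letI θ := Summit.QuantumFields.YangMills.Theorems.K0RecordFormatNames.thetaFill F a₀ ε₂₉; letI := θ.instVβ₁; letI := θ.instVβ₂; letI := θ.instιβ; AnalyticAt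 ℝ (fun B : Summit.QuantumFields.YangMills.Theorems.K0RecordFormatNames.recordW F a₀ ε₂₉ k (Summit.QuantumFields.YangMills.Theorems.K0RecordFormatNames.recordK₀ F Mc k + n) => fun (b : Literature.MathematicalPhysics.QuantumFieldTheory.Balaban1983to89.PBond (F.P (Summit.QuantumFields.YangMills.Theorems.K0RecordFormatNames.recordK₀ F Mc k + n)) 0) (i i' : Fin 2) => ((Summit.QuantumFields.YangMills.Theorems.K0RecordFormatNames.recordBgField F θ k (Summit.QuantumFields.YangMills.Theorems.K0RecordFormatNames.recordK₀ F Mc k + n) B b : Literature.MathematicalPhysics.QuantumFieldTheory.Balaban1983to89.Node00.SU 2) : Matrix (Fin 2) (Fin 2) ℂ) i i') 0) → (∃ C₉' δ₉ : ℝ, 0 ≤ C₉' ∧ 0 < δ₉ ∧ ∀ (k n : ℕ) (ε₂₉ : ℝ), 0 < ε₂₉ → letI θ := Summit.QuantumFields.YangMills.Theorems.K0RecordFormatNames.thetaFill F a₀ ε₂₉; letI := θ.instVβ₁; letI := θ.instVβ₂; letI := θ.instιβ; ∀ (a : θ.ιβ) (μ : Fin (F.P (Summit.QuantumFields.YangMills.Theorems.K0RecordFormatNames.recordK₀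 F Mc k + n)).d) (y : Literature.MathematicalPhysics.QuantumFieldTheory.Balaban1983to89.Site (F.P (Summit.QuantumFields.YangMills.Theorems.K0RecordFormatNames.recordK₀ F Mc k + n)) (k + 1)), letI D := fderiv ℝ (fun B : Summit.QuantumFields.YangMills.Theorems.K0RecordFormatNames.recordW F a₀ ε₂₉ k (Summit.QuantumFields.YangMills.Theorems.K0RecordFormatNames.recordK₀ F Mc k + n) => fun (b : Literature.MathematicalPhysics.QuantumFieldTheory.Balaban1983to89.PBond (F.P (Summit.QuantumFields.YangMills.Theorems.K0RecordFormatNames.recordK₀ F Mc k + n)) 0) (i i' : Fin 2) => ((Summit.QuantumFields.YangMills.Theorems.K0RecordFormatNames.recordBgField F θ k (Summit.QuantumFields.YangMills.Theorems.K0RecordFormatNames.recordK₀ F Mc k + n) B b : Literature.MathematicalPhysics.QuantumFieldTheory.Balaban1983to89.Node00.SU 2) : Matrix (Fin 2) (Fin 2) ℂ) i i') 0 (Pi.single μ (Pi.single y (θ.bV a))); ∃ (Hr : Literature.MathematicalPhysics.QuantumFieldTheory.Balaban1983to89.PBond (F.P (Summit.QuantumFields.YangMills.Theorems.K0RecordFormatNames.recordK₀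 F Mc k + n)) 0 → Fin 2 → Fin 2 → ℂ) (φ : Literature.MathematicalPhysics.QuantumFieldTheory.Balaban1983to89.Site (F.P (Summit.QuantumFields.YangMills.Theorems.K0RecordFormatNames.recordK₀ F Mc k + n)) 0 → Fin 2 → Fin 2 → ℂ), (∀ b : Literature.MathematicalPhysics.QuantumFieldTheory.Balaban1983to89.PBond (F.P (Summit.QuantumFields.YangMills.Theorems.K0RecordFormatNames.recordK₀ F Mc k + n)) 0, D b = Hr b + (φ b.src - φ (b.src.shift b.dir))) ∧ (∃ μc : Literature.MathematicalPhysics.QuantumFieldTheory.Balaban1983to89.Site (F.P (Summit.QuantumFields.YangMills.Theorems.K0RecordFormatNames.recordK₀ F Mc k + n)) (k + 1) → Fin 2 → Fin 2 → ℂ, ∀ x : Literature.MathematicalPhysics.QuantumFieldTheory.Balaban1983to89.Site (F.P (Summit.QuantumFields.YangMills.Theorems.K0RecordFormatNames.recordK₀ F Mc k + n)) 0, letI dv := (fun x' : Literature.MathematicalPhysics.QuantumFieldTheory.Balaban1983to89.Site (F.P (Summit.QuantumFields.YangMills.Theorems.K0RecordFormatNames.recordK₀ F Mc k + n)) 0 =>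 ∑ ν : Fin (F.P (Summit.QuantumFields.YangMills.Theorems.K0RecordFormatNames.recordK₀ F Mc k + n)).d, (Hr ⟨x', ν⟩ - Hr ⟨x'.unshift ν, ν⟩)); ∑ ν : Fin (F.P (Summit.QuantumFields.YangMills.Theorems.K0RecordFormatNames.recordK₀ F Mc k + n)).d, (dv (x.shift ν) - (2 : ℂ) • dv x + dv (x.unshift ν)) = μc (Summit.QuantumFields.YangMills.Theorems.K0RecordFormatNames.coarsenTo (k + 1) x)) ∧ ∀ b : Literature.MathematicalPhysics.QuantumFieldTheory.Balaban1983to89.PBond (F.P (Summit.QuantumFields.YangMills.Theorems.K0RecordFormatNames.recordK₀ F Mc k + n)) 0, ‖Hr b‖ ≤ C₉' * (F.P (Summit.QuantumFields.YangMills.Theorems.K0RecordFormatNames.recordK₀ F Mc k + n)).eta (k + 1) * Real.exp (-(δ₉ * (Literature.MathematicalPhysics.QuantumFieldTheory.Balaban1983to89.Site.tdist (Summit.QuantumFields.YangMills.Theorems.K0RecordFormatNames.coarsenTo (k + 1) b.src) y : ℝ))) ∧ (∀ ν : Fin (F.P (Summit.QuantumFields.YangMills.Theorems.K0RecordFormatNames.recordK₀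 F Mc k + n)).d, ‖Hr (⟨b.src.shift ν, b.dir⟩ : Literature.MathematicalPhysics.QuantumFieldTheory.Balaban1983to89.PBond (F.P (Summit.QuantumFields.YangMills.Theorems.K0RecordFormatNames.recordK₀ F Mc k + n)) 0) - Hr b‖ ≤ C₉' * (F.P (Summit.QuantumFields.YangMills.Theorems.K0RecordFormatNames.recordK₀ F Mc k + n)).eta (k + 1) ^ 2 * Real.exp (-(δ₉ * (Literature.MathematicalPhysics.QuantumFieldTheory.Balaban1983to89.Site.tdist (Summit.QuantumFields.YangMills.Theorems.K0RecordFormatNames.coarsenTo (k + 1) b.src) y : ℝ)))) ∧ ‖∑ ν : Fin (F.P (Summit.QuantumFields.YangMills.Theorems.K0RecordFormatNames.recordK₀ F Mc k + n)).d, (Hr (⟨b.src.shift ν, b.dir⟩ : Literature.MathematicalPhysics.QuantumFieldTheory.Balaban1983to89.PBond (F.P (Summit.QuantumFields.YangMills.Theorems.K0RecordFormatNames.recordK₀ F Mc k + n)) 0) - (2 : ℂ) • Hr b + Hr (⟨b.src.unshift ν, b.dir⟩ : Literature.MathematicalPhysics.QuantumFieldTheory.Balaban1983to89.PBond (F.P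 (Summit.QuantumFields.YangMills.Theorems.K0RecordFormatNames.recordK₀ F Mc k + n)) 0))‖ ≤ C₉' * (F.P (Summit.QuantumFields.YangMills.Theorems.K0RecordFormatNames.recordK₀ F Mc k + n)).eta (k + 1) ^ 3 * Real.exp (-(δ₉ * (Literature.MathematicalPhysics.QuantumFieldTheory.Balaban1983to89.Site.tdist (Summit.QuantumFields.YangMills.Theorems.K0RecordFormatNames.coarsenTo (k + 1) b.src) y : ℝ))) ∧ ‖∑ ν : Fin (F.P (Summit.QuantumFields.YangMills.Theorems.K0RecordFormatNames.recordK₀ F Mc k + n)).d, ((Hr (⟨b.src, b.dir⟩ : Literature.MathematicalPhysics.QuantumFieldTheory.Balaban1983to89.PBond (F.P (Summit.QuantumFields.YangMills.Theorems.K0RecordFormatNames.recordK₀ F Mc k + n)) 0) + Hr (⟨(b.src).shift b.dir, ν⟩ : Literature.MathematicalPhysics.QuantumFieldTheory.Balaban1983to89.PBond (F.P (Summit.QuantumFields.YangMills.Theorems.K0RecordFormatNames.recordK₀ F Mc k + n)) 0) - Hr (⟨(b.src).shift ν, b.dir⟩ : Literature.MathematicalPhysics.QuantumFieldTheory.Balaban1983to89.PBond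 (F.P (Summit.QuantumFields.YangMills.Theorems.K0RecordFormatNames.recordK₀ F Mc k + n)) 0) - Hr (⟨b.src, ν⟩ : Literature.MathematicalPhysics.QuantumFieldTheory.Balaban1983to89.PBond (F.P (Summit.QuantumFields.YangMills.Theorems.K0RecordFormatNames.recordK₀ F Mc k + n)) 0)) - (Hr (⟨b.src.unshift ν, b.dir⟩ : Literature.MathematicalPhysics.QuantumFieldTheory.Balaban1983to89.PBond (F.P (Summit.QuantumFields.YangMills.Theorems.K0RecordFormatNames.recordK₀ F Mc k + n)) 0) + Hr (⟨(b.src.unshift ν).shift b.dir, ν⟩ : Literature.MathematicalPhysics.QuantumFieldTheory.Balaban1983to89.PBond (F.P (Summit.QuantumFields.YangMills.Theorems.K0RecordFormatNames.recordK₀ F Mc k + n)) 0) - Hr (⟨(b.src.unshift ν).shift ν, b.dir⟩ : Literature.MathematicalPhysics.QuantumFieldTheory.Balaban1983to89.PBond (F.P (Summit.QuantumFields.YangMills.Theorems.K0RecordFormatNames.recordK₀ F Mc k + n)) 0) - Hr (⟨b.src.unshift ν, ν⟩ : Literature.MathematicalPhysics.QuantumFieldTheory.Balaban1983to89.PBond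 (F.P (Summit.QuantumFields.YangMills.Theorems.K0RecordFormatNames.recordK₀ F Mc k + n)) 0)))‖ ≤ C₉' * (F.P (Summit.QuantumFields.YangMills.Theorems.K0RecordFormatNames.recordK₀ F Mc k + n)).eta (k + 1) ^ 3 * Real.exp (-(δ₉ * (Literature.MathematicalPhysics.QuantumFieldTheory.Balaban1983to89.Site.tdist (Summit.QuantumFields.YangMills.Theorems.K0RecordFormatNames.coarsenTo (k + 1) b.src) y : ℝ)))) → ∀ εp : ℝ, 0 < εp → ∃ ε₂₉ : ℝ, 0 < ε₂₉ ∧ ε₂₉ ≤ εp ∧ ∀ (E₁ κ₁ β₀ β₁ δ₀ : ℝ), 0 ≤ E₁ → 4 * Literature.MathematicalPhysics.QuantumFieldTheory.Balaban1983to89.B12TreeDecay.kappa₀ (4 * 2 ^ 4) (2 * 4) ≤ κ₁ → 0 < β₀ → 0 < β₁ → 0 < δ₀ → (∀ k : ℕ, Summit.QuantumFields.YangMills.Theorems.BalabanUVNodesPortS1.LZResidueRegAt F Mc a₀ ε₂₉ β₀ β₁ δ₀ E₁ κ₁ k) → ∃ α₀ α₁ : ℝ, 0 < α₀ ∧ 0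 < α₁ ∧ ∀ εcap : ℝ, 0 < εcap → ∃ γ₀ ε₀ A R E₂ κ : ℝ, 0 < γ₀ ∧ 0 < ε₀ ∧ ε₀ ≤ εcap ∧ 0 ≤ A ∧ 0 ≤ E₂ ∧ 4 * Literature.MathematicalPhysics.QuantumFieldTheory.Balaban1983to89.B12TreeDecay.kappa₀ (4 * 2 ^ 4) (2 * 4) ≤ κ ∧ κ + 2 * Literature.MathematicalPhysics.QuantumFieldTheory.Balaban1983to89.B12TreeDecay.kappa₀ (4 * 2 ^ 4) (2 * 4) + 2 ≤ R ∧ A * Real.exp (5 * κ + 1) * Literature.MathematicalPhysics.QuantumFieldTheory.Balaban1983to89.B12TreeDecay.K₀ (4 * 2 ^ 4) (2 * 4) * 9 * 64 ≤ 1 ∧ 2 * (Real.exp 1 * 9 * 64 * Literature.MathematicalPhysics.QuantumFieldTheory.Balaban1983to89.B12TreeDecay.K₀ (4 * 2 ^ 4) (2 * 4) ^ 2 * A) ≤ E₂ ∧ ∀ k : ℕ, (∀ j : ℕ, j < k → Summit.QuantumFields.YangMills.Theorems.BalabanUVNodesPortS1.FEResidueRegBoxAt F Mc a₀ ε₂₉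 γ₀ α₀ α₁ ε₀ E₂ κ j) → ∀ v : Fin (k + 1) → ℝ, v ∈ Literature.MathematicalPhysics.QuantumFieldTheory.Balaban1983to89.FlowStep.Box γ₀ k → ∃ (Hi : Summit.QuantumFields.YangMills.Theorems.K0RecordFormatNames.IntLocalFormula (F.L ^ (k + 1) * Mc)) (Hw : Summit.QuantumFields.YangMills.Theorems.K0RecordFormatNames.TorusPieces F Mc k), Summit.QuantumFields.YangMills.Theorems.BalabanUVNodesPortS1.PolymerRepOnRegW F Mc k Hi Hw a₀ ε₂₉ α₀ α₁ ε₀ A R (Summit.QuantumFields.YangMills.Theorems.BalabanUVNodesPortS1.feFluctDiff F Mc a₀ ε₂₉ k v)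

/-- ★★ **S₄ `FEPolymerResummation F` — THE KP RESUMMATION AT THE RECORD (M–L; bytes in hand)**: at ONE level, frame-free, for every ADMISSIBLE cube size (`McGuard`, as in
✓`PowMemberIntTwin`): a W-format activity system with the
Π-rep rows at `(A, R)`, the (2.41) numerics, the class nesting and the ε₀-regularity of `B = 0` give ONE integer-local formula `Ψ` + wrap pieces `Ew`
(the `X`-localised parts `E^{(k+1)}(X) = Σ_{∪Zᵢ = X} ρ^T H(Z₁)⋯H(Z_n)` of `log Ξ`, by difference at `B` and `0`) with the seven rows of ✓`ResidueOnRegAtW`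
at `(E₂, κ)` for `Φ`.  Tree material: `B13Resummation.{locE, locE_congr, logZ_eq_sum_locE, exp_sum_locE_eq_Z, norm_locE_le_of_small}`,
`TreeLengthTorusGeometry.{tgeometry, tgeometry_consts_four, ineq227_tcubes}`, `ClusterExpansion.exp_polymerLogZ_of_kp`, ✓`recordBgField_zero`∕✓`recordCurrent_zero`.
OPEN (M–L, NO Bałaban antecedent — takeable now); inhabited nowhere; a CANDIDATE letter of the №634 sub-split (D-0026: not a fact; asserted for nothing).
[cite: Balaban1988RG2Cluster, (2.12)–(2.13) p.14, (2.39)–(2.41) p.21; Balaban1987RG1, (1.7) p.261, (1.18)–(1.19) p.263; KoteckyPreiss1986, Thm 1] -/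
def FEPolymerResummation (F : T4Family) : Prop :=
  ∀ (Mc k : ℕ) (a₀ ε₂₉ α₀ α₁ ε₀ A R E₂ κ : ℝ) (Hi : IntLocalFormula (F.L ^ (k + 1) * Mc)) (Hw : TorusPieces F Mc k)
    (Φf : (n : ℕ) → recordW F a₀ ε₂₉ k (recordK₀ F Mc k + n) → ℂ),
    McGuard F Mc → 0 ≤ A → 4 * Literature.MathematicalPhysics.QuantumFieldTheory.Balaban1983to89.B12TreeDecay.kappa₀ (4 * 2 ^ 4) (2 * 4) ≤ κ → κ + 2 * Literature.MathematicalPhysics.QuantumFieldTheory.Balaban1983to89.B12TreeDecay.kappa₀ (4 * 2 ^ 4) (2 * 4) + 2 ≤ R →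
    A * Real.exp (5 * κ + 1) * Literature.MathematicalPhysics.QuantumFieldTheory.Balaban1983to89.B12TreeDecay.K₀ (4 * 2 ^ 4) (2 * 4) * 9 * 64 ≤ 1 → 2 * (Real.exp 1 * 9 * 64 * Literature.MathematicalPhysics.QuantumFieldTheory.Balaban1983to89.B12TreeDecay.K₀ (4 * 2 ^ 4) (2 * 4) ^ 2 * A) ≤ E₂ →
    (∀ n (B : recordW F a₀ ε₂₉ k (recordK₀ F Mc k + n)), InRegClass F Mc k ε₀ a₀ ε₂₉ n B → CutsInUc F Mc k α₀ α₁ a₀ ε₂₉ n B) →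
    (∀ n, letI θ := thetaFill F a₀ ε₂₉; letI := θ.instVβ₁; letI := θ.instVβ₂; letI := θ.instιβ
      InRegClass F Mc k ε₀ a₀ ε₂₉ n (0 : recordW F a₀ ε₂₉ k (recordK₀ F Mc k + n))) →
    PolymerRepOnRegW F Mc k Hi Hw a₀ ε₂₉ α₀ α₁ ε₀ A R Φf →
    ∃ (Ψ : IntLocalFormula (F.L ^ (k + 1) * Mc)) (Ew : TorusPieces F Mc k), Ψ.ResidueOnRegAtW F Mc k Ew a₀ ε₂₉ α₀ α₁ ε₀ E₂ κ Φf

/-- **The antecedent-free nesting letter implies the (α) edition**: ▶ PT-A's ✓`ClassNestsUc` gives ONE `εn > 0`; every `ε₀ ≤ εn` is served because the ε₀-class GROWS with `ε₀`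
(✓`inRegClass_mono`). Bookkeeping. [cite: Balaban1987RG1, p.263 L5–13, (1.1)–(1.2) p.260 (bookkeeping)] -/
theorem regClassNestsUc_of_classNestsUc (h : ∀ F, ClassNestsUc F) : ∀ F, RegClassNestsUc F := by
  intro F
  refine ⟨0, fun Mc _ j c c₀ c₁ B₃ B₃' a₀ a₁ hG _ _ _ _ _ h₆ _ _ _ _ _ _ ε₂₉ α₀ α₁ hε hα₀ hα₁ => ?_⟩
  obtain ⟨εn, hεn, H⟩ := h F Mc a₀ ε₂₉ α₀ α₁ hG h₆ hε hα₀ hα₁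
  exact ⟨εn, hεn, fun ε₀ _ hle k n B hB => H k n B (inRegClass_mono hle hB)⟩


/-! ## §3  ★★★ The glue: S₁ ∧ S₂ ∧ S₃ ∧ S₄ ⟹ `FEStepReg` (given the P0-ℂ letter) -/

/-- ★★★ **`FEStepReg` FROM THE FOUR PIECES** (and `stub_P0C`'s letter, which S₁ consumes): S₃ fixes `ε₂₉ ≤ εp` (S₁'s bound) and `(α₀, α₁)`; S₁ and S₂ cap the
class radius; S₃ returns k-uniform constants with `ε₀` under both caps and, at `(k, v)`, the activity system; S₄ resums it into `(Ψ, Ew)` for `feFluctDiff`,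
whose (f′)-Reg row is transported to `phiFE` along S₁'s identity on the class (the six functional-free rows do not read `Φ`); the ε₀-regularity of `B = 0`
is ✓`eventually_inRegClass` at the antecedent's `hP9`∕`hTE`.  CONDITIONAL bookkeeping; the four letters OPEN. [cite: Balaban1987RG1, (2.12)–(2.14) p.268, p.268 L27–31, Thm 3 p.264] -/
theorem feStepReg_of_polymerPieces (hP0C : ∀ F, P0HolExtAtRecordGL F) (hS₁ : ∀ F, FEChartLawReg F) (hS₂ : ∀ F, RegClassNestsUc F)
    (hS₃ : ∀ F, FEPolymerActivitiesReg F) (hS₄ : ∀ F, FEPolymerResummation F) : ∀ F, FEStepReg F := by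
  intro F
  obtain ⟨M₁, H₁⟩ := hS₁ F
  obtain ⟨M₂, H₂⟩ := hS₂ F
  obtain ⟨M₃, H₃⟩ := hS₃ F
  refine ⟨max (max M₁ M₂) M₃, fun Mc hMc j c c₀ c₁ B₃ B₃' a₀ a₁ hG h₁ h₂ h₃ h₄ h₅ h₆ h₇ hT8 hT9 hTE hP9 hP9L => ?_⟩
  have hM₁ : M₁ ≤ Mc := le_trans (le_max_left _ _) (le_of_max_le_left hMc)
  have hM₂ : M₂ ≤ Mc := le_trans (le_max_right _ _) (le_of_max_le_left hMc)
  have hM₃ : M₃ ≤ Mc := le_of_max_le_right hMc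
  obtain ⟨εp, hεp, HC⟩ := H₁ Mc hM₁ j c c₀ c₁ B₃ B₃' a₀ a₁ hG h₁ h₂ h₃ h₄ h₅ h₆ h₇ hT8 hT9 hTE hP9 hP9L (hP0C F)
  have HN := H₂ Mc hM₂ j c c₀ c₁ B₃ B₃' a₀ a₁ hG h₁ h₂ h₃ h₄ h₅ h₆ h₇ hT8 hT9 hTE hP9 hP9L
  obtain ⟨ε₂₉, hε, hεle, HA⟩ := H₃ Mc hM₃ j c c₀ c₁ B₃ B₃' a₀ a₁ hG h₁ h₂ h₃ h₄ h₅ h₆ h₇ hT8 hT9 hTE hP9 hP9L εp hεp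
  obtain ⟨εc, hεc, HC'⟩ := HC ε₂₉ hε hεle
  refine ⟨ε₂₉, hε, fun E₁ κ₁ β₀ β₁ δ₀ hE₁ hκ₁ hβ₀ hβ₁ hδ₀ HLZ => ?_⟩
  obtain ⟨α₀, α₁, hα₀, hα₁, HA'⟩ := HA E₁ κ₁ β₀ β₁ δ₀ hE₁ hκ₁ hβ₀ hβ₁ hδ₀ HLZ
  obtain ⟨εn, hεn, HN'⟩ := HN ε₂₉ α₀ α₁ hε hα₀ hα₁
  obtain ⟨γ₀, ε₀, A, R, E₂, κ, hγ, hε₀, hε₀le, hA, hE₂, hκ, hR, hsm, hAE, Hstep⟩ := HA' (min εc εn) (lt_min hεc hεn)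
  -- the antecedent's [15] Thm 1 token at the admissible radius `ε₁ := min a₁ (a₀ ∕ B₃)` (as in ✓`portRecordFEHalfBox_of_reg`)
  have hL1 : (1 : ℝ) ≤ (F.L : ℝ) := by exact_mod_cast F.hL.2.le
  have hB₃ : 0 < B₃ := lt_of_lt_of_le (by positivity : (0 : ℝ) < 2 * (F.L : ℝ) ^ 2) h₄
  have hε₁ : 0 < min a₁ (a₀ / B₃) := lt_min h₇ (div_pos h₆ hB₃)
  have hUk := hTE (min a₁ (a₀ / B₃)) hε₁ (min_le_left _ _)
    (by rw [← le_div_iff₀' hB₃]; exact min_le_right _ _)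
  refine ⟨γ₀, E₂, κ, α₀, α₁, ε₀, hγ, hE₂, hκ, hα₀, hα₁, hε₀, fun k ih v hv => ?_⟩
  obtain ⟨Hi, Hw, hrep⟩ := Hstep k ih v hv
  have hnest : ∀ n (B : recordW F a₀ ε₂₉ k (recordK₀ F Mc k + n)), InRegClass F Mc k ε₀ a₀ ε₂₉ n B → CutsInUc F Mc k α₀ α₁ a₀ ε₂₉ n B :=
    fun n B hB => HN' ε₀ hε₀ (le_trans hε₀le (min_le_right _ _)) k n B hB
  have h0 : ∀ n, letI θ := thetaFill F a₀ ε₂₉; letI := θ.instVβ₁; letI := θ.instVβ₂; letI := θ.instιβ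
      InRegClass F Mc k ε₀ a₀ ε₂₉ n (0 : recordW F a₀ ε₂₉ k (recordK₀ F Mc k + n)) :=
    fun n => by
      letI θ := thetaFill F a₀ ε₂₉; letI := θ.instVβ₁; letI := θ.instVβ₂; letI := θ.instιβ
      exact (eventually_inRegClass F a₀ ε₂₉ Mc k n (hP9 k n ε₂₉ hε) hε₁ (hUk k n) hε₀).self_of_nhds
  obtain ⟨Ψ, Ew, hres⟩ := hS₄ F Mc k a₀ ε₂₉ α₀ α₁ ε₀ A R E₂ κ Hi Hw (feFluctDiff F Mc a₀ ε₂₉ k v) hG hA hκ hR hsm hAE hnest h0 hrep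
  have hid : ∀ n (B : recordW F a₀ ε₂₉ k (recordK₀ F Mc k + n)), InRegClass F Mc k ε₀ a₀ ε₂₉ n B →
      phiFE F Mc a₀ ε₂₉ k v n B = feFluctDiff F Mc a₀ ε₂₉ k v n B :=
    HC' E₁ κ₁ β₀ β₁ δ₀ hE₁ hκ₁ hβ₀ hβ₁ hδ₀ HLZ γ₀ E₂ κ α₀ α₁ ε₀ hγ hE₂ hκ hα₀ hα₁ hε₀ (le_trans hε₀le (min_le_left _ _)) k ih v hv
  exact ⟨Ψ, Ew, hres.1, hres.2.1, hres.2.2.1, hres.2.2.2.1, hres.2.2.2.2.1, hres.2.2.2.2.2.1,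
    fun n B hB => (hid n B hB).trans (hres.2.2.2.2.2.2 n B hB)⟩


end Summit.QuantumFields.YangMills.Theorems.BalabanUVNodesPortS1

end
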